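import Mathlib
import HarnessLib

/-!
# Route EternalPapapetrou · SchwarzschildExteriorModeRigidity — parametric integrals

Helper file for item stmt-FinalStateConjecture-10039 (`SchwarzschildExteriorModeRigidity`).

Continuity and differentiation under the integral sign for integrals over a compact finite
measure space (the unit sphere) of jointly continuous data, localised on an open parameter set
(Mathlib's `hasFDerivAt_integral_of_dominated_of_fderiv_le`, `continuousAt_of_dominated` with
constant bounds from compactness), and the packaging of two such derivatives into
`ContDiffOn ℝ 2`. [folklore]
-/

set_option linter.dupNamespace false

noncomputable section

namespace Summit.FinalStateConjecture.FinalStateConjecture.Theorems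

open MeasureTheory Set Filter Topology Metric

namespace EternalPapapetrou.ModeRigidity

section Param

variable {P G : Type*} [NormedAddCommGroup P] [NormedSpace ℝ P] [ProperSpace P]
  [NormedAddCommGroup G] [NormedSpace ℝ G]
  {Y : Type*} [TopologicalSpace Y] [CompactSpace Y] [MeasurableSpace Y] [OpensMeasurableSpace Y]
  [SecondCountableTopology Y] {μ : Measure Y} [IsFiniteMeasure μ]

omit [NormedSpace ℝ P] [NormedSpace ℝ G] [ProperSpace P] [CompactSpace Y] [MeasurableSpace Y]
  [OpensMeasurableSpace Y] [SecondCountableTopology Y] in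
/-- Slices in `y` of a jointly continuous integrand are continuous. [folklore] -/
theorem continuous_slice_right {F : P → Y → G} {Ω : Set P}
    (hF : ContinuousOn (fun qy : P × Y ↦ F qy.1 qy.2) (Ω ×ˢ univ)) {q : P} (hq : q ∈ Ω) :
    Continuous fun y ↦ F q y :=
  hF.comp_continuous (continuous_const.prodMk continuous_id) fun _ ↦ ⟨hq, mem_univ _⟩

omit [NormedSpace ℝ P] [NormedSpace ℝ G] [ProperSpace P] [CompactSpace Y] [MeasurableSpace Y]
  [OpensMeasurableSpace Y] [SecondCountableTopology Y] in
/-- Slices in the parameter of a jointly continuous integrand are continuous. [folklore] -/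
theorem continuousOn_slice_left {F : P → Y → G} {Ω : Set P}
    (hF : ContinuousOn (fun qy : P × Y ↦ F qy.1 qy.2) (Ω ×ˢ univ)) (y : Y) :
    ContinuousOn (fun q ↦ F q y) Ω :=
  hF.comp (continuousOn_id.prodMk continuousOn_const) fun _ hq ↦ ⟨hq, mem_univ _⟩

omit [NormedSpace ℝ P] in
/-- **Continuity of parametric integrals** over a compact finite measure space, for jointly
continuous integrands, on an open parameter set. [folklore] -/
theorem continuousOn_integral_of_continuousOn {F : P → Y → G} {Ω : Set P} (hΩ : IsOpen Ω)
    (hF : ContinuousOn (fun qy : P × Y ↦ F qy.1 qy.2) (Ω ×ˢ univ)) :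
    ContinuousOn (fun q ↦ ∫ y, F q y ∂μ) Ω := by
  intro p hp
  obtain ⟨ε, hε, hball⟩ := Metric.mem_nhds_iff.1 (hΩ.mem_nhds hp)
  have hcb : closedBall p (ε / 2) ⊆ Ω := (closedBall_subset_ball (by linarith)).trans hball
  have hK : IsCompact (closedBall p (ε / 2) ×ˢ (univ : Set Y)) :=
    (isCompact_closedBall _ _).prod isCompact_univ
  obtain ⟨B, hB⟩ := hK.exists_bound_of_continuousOn (hF.mono (prod_mono hcb Subset.rfl))
  refine (continuousAt_of_dominated (bound := fun _ ↦ B) ?_ ?_ (integrable_const B) ?_)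
    |>.continuousWithinAt
  · filter_upwards [hΩ.mem_nhds hp] with q hq using
      (continuous_slice_right hF hq).aestronglyMeasurable
  · filter_upwards [closedBall_mem_nhds p (by positivity : (0 : ℝ) < ε / 2)] with q hq
    exact Eventually.of_forall fun y ↦ hB (q, y) ⟨hq, mem_univ _⟩
  · exact Eventually.of_forall fun y ↦ (continuousOn_slice_left hF y).continuousAt
      (hΩ.mem_nhds hp)

/-- **Differentiation under the integral sign** over a compact finite measure space, for jointly
continuous `F` and `F'` with `HasFDerivAt (F · y) (F' q y) q` on an open parameter set.
[folklore] -/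
theorem hasFDerivAt_integral_of_continuousOn [CompleteSpace G] {F : P → Y → G}
    {F' : P → Y → P →L[ℝ] G} {Ω : Set P} (hΩ : IsOpen Ω)
    (hF : ContinuousOn (fun qy : P × Y ↦ F qy.1 qy.2) (Ω ×ˢ univ))
    (hF' : ContinuousOn (fun qy : P × Y ↦ F' qy.1 qy.2) (Ω ×ˢ univ))
    (hd : ∀ q ∈ Ω, ∀ y, HasFDerivAt (F · y) (F' q y) q) {p : P} (hp : p ∈ Ω) :
    HasFDerivAt (fun q ↦ ∫ y, F q y ∂μ) (∫ y, F' p y ∂μ) p := by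
  obtain ⟨ε, hε, hball⟩ := Metric.mem_nhds_iff.1 (hΩ.mem_nhds hp)
  have hcb : closedBall p (ε / 2) ⊆ Ω := (closedBall_subset_ball (by linarith)).trans hball
  have hK : IsCompact (closedBall p (ε / 2) ×ˢ (univ : Set Y)) :=
    (isCompact_closedBall _ _).prod isCompact_univ
  obtain ⟨B, hB⟩ := hK.exists_bound_of_continuousOn (hF'.mono (prod_mono hcb Subset.rfl))
  obtain ⟨B₀, hB₀⟩ := (isCompact_univ (X := Y)).exists_bound_of_continuousOn
    (continuous_slice_right hF hp).continuousOn
  refine hasFDerivAt_integral_of_dominated_of_fderiv_le (bound := fun _ ↦ B)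
    (closedBall_mem_nhds p (by positivity : (0 : ℝ) < ε / 2)) ?_ ?_ ?_ ?_ (integrable_const B) ?_
  · filter_upwards [hΩ.mem_nhds hp] with q hq using
      (continuous_slice_right hF hq).aestronglyMeasurable
  · exact (integrable_const B₀).mono' (continuous_slice_right hF hp).aestronglyMeasurable
      (Eventually.of_forall fun y ↦ hB₀ y (mem_univ _))
  · exact (continuous_slice_right hF' hp).aestronglyMeasurable
  · exact Eventually.of_forall fun y q hq ↦ hB (q, y) ⟨hq, mem_univ _⟩
  · exact Eventually.of_forall fun y q hq ↦ hd q (hcb hq) y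

omit [ProperSpace P] in
/-- Two derivatives with a continuous second derivative give `C²` on an open set. [folklore] -/
theorem contDiffOn_two_of_hasFDerivAt {u : P → G} {u₁ : P → P →L[ℝ] G}
    {u₂ : P → P →L[ℝ] P →L[ℝ] G} {Ω : Set P} (hΩ : IsOpen Ω)
    (h₁ : ∀ q ∈ Ω, HasFDerivAt u (u₁ q) q) (h₂ : ∀ q ∈ Ω, HasFDerivAt u₁ (u₂ q) q)
    (h₃ : ContinuousOn u₂ Ω) : ContDiffOn ℝ 2 u Ω := by
  have e1 : ∀ q ∈ Ω, fderiv ℝ u q = u₁ q := fun q hq ↦ (h₁ q hq).fderiv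
  have e2 : ∀ q ∈ Ω, fderiv ℝ u₁ q = u₂ q := fun q hq ↦ (h₂ q hq).fderiv
  have h1 : ContDiffOn ℝ 1 u₁ Ω := by
    rw [show (1 : WithTop ℕ∞) = (0 : WithTop ℕ∞) + 1 from rfl,
      contDiffOn_succ_iff_fderiv_of_isOpen hΩ]
    refine ⟨fun q hq ↦ (h₂ q hq).differentiableAt.differentiableWithinAt, fun h ↦ ?_, ?_⟩
    · exact absurd h (by simp)
    · exact contDiffOn_zero.2 (h₃.congr fun q hq ↦ e2 q hq)
  rw [show (2 : WithTop ℕ∞) = (1 : WithTop ℕ∞) + 1 from rfl,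
    contDiffOn_succ_iff_fderiv_of_isOpen hΩ]
  refine ⟨fun q hq ↦ (h₁ q hq).differentiableAt.differentiableWithinAt, fun h ↦ ?_, ?_⟩
  · exact absurd h (by simp)
  · exact h1.congr fun q hq ↦ e1 q hq

end Param

end EternalPapapetrou.ModeRigidity

end Summit.FinalStateConjecture.FinalStateConjecture.Theorems
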